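import Mathlib
import HarnessLib

-- provenance: harness21/H21/H21/Statements/Hilbert6/Wave0.lean @ ebe2200 (interim HEAD d8f2665); M5 mechanical rewrite
/-!
# Hilbert's sixth problem (family `hilbert6`), wave 0: the hard-sphere collision operator

This file states, on top of Mathlib alone, the parts of the `hilbert6` inventory that only need
the *velocity-space* side of kinetic theory:

* **hilbert6.S09** (definition): the elastic collision law `(v, v_*) ↦ (v', v_*')`, the
  hard-sphere Boltzmann collision operator
  `Q(f, g)(v) = ∫_{ℝ^d} ∫_{S^{d-1}} ((v - v_*)·ω)_+ [f(v') g(v_*') - f(v) g(v_*)] dω dv_*`,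
  its gain and loss parts, collision invariants (`1`, `v`, `|v|²` are invariants) and the weak
  (symmetrised) formulation against a test function.
* **hilbert6.S12** (known theorem): Boltzmann's H-theorem `∫ Q(f,f) log f dv ≤ 0`, with equality
  iff `f` is a Maxwellian (velocity dimension `≥ 2`), and `Q(M, M) = 0` for Maxwellians `M`.

Skipped (all other ids of the family, S01–S08, S10, S11, S13–S22): each needs at least one of the
`M`-sized absent notions of the inventory — the hard-sphere phase space and a.e.-defined
hard-sphere flow (S01–S07, S14, S18, S20, S22), BBGKY marginals / Boltzmann–Grad convergence
modes (S01–S03, S06–S08, S14, S20), mild *and* DiPerna–Lions renormalized solution classes with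
the free-transport semigroup (S10, S11, S13, S16, S17), hydrodynamic scalings and Leray–Hopf
solutions (S15–S18), the linearised collision operator with its pseudo-inverse (S19), or the wave
kinetic equation (S21). None of these fits in the ~60 lines of routine glue allowed here.

Sources: Cercignani–Illner–Pulvirenti, *The Mathematical Theory of Dilute Gases* (1994) §3.1–3.3;
Villani, *A review of mathematical topics in collisional kinetic theory*, Handbook Math. Fluid
Dyn. I (2002) Ch. 1 §2, §2.4; Gallagher–Saint-Raymond–Texier, *From Newton to Boltzmann: hard
spheres and short-range potentials* (2013) §2.

Design choices.
* The velocity space is a finite-dimensional real inner product space `E` with its canonical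
  Lebesgue measure `volume` (Mathlib's `measureSpaceOfInnerProductSpace`), rather than
  `EuclideanSpace ℝ (Fin d)`; the surface measure on `S^{d-1} = Metric.sphere (0 : E) 1` is
  Mathlib's `volume.toSphere`.
* The kernel is the hard-sphere kernel `((v - v_*)·ω)_+` integrated over the *whole* sphere
  (GST 2013 convention); other texts use `|(v - v_*)·ω|` and a factor `1/2`.
* `collisionOp f g` is the Bochner integral of the *difference* gain − loss (junk value `0` when not
  integrable, as for every Bochner integral); `collisionGain`/`collisionLoss` are provided
  separately. Integrability side conditions appear as explicit hypotheses in the theorems, phrased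
  on the three-fold integrand over `E × E × S^{d-1}`.
* "Maxwellian" in the equality case of the H-theorem is taken in the wide sense
  `f v = exp (a + ⟪b, v⟫ + c ‖v‖²)`; no integrability of `f` is assumed, so `c < 0` is not forced.
-/

open MeasureTheory Metric Real
open scoped InnerProductSpace

namespace Literature.MathematicalPhysics.KineticTheory

noncomputable section

variable {E : Type*} [NormedAddCommGroup E] [InnerProductSpace ℝ E]

/-! ### Elastic collision law (glue for `hilbert6.S09`) -/

/-- The elastic (hard-sphere) collision law: for an impact direction `ω ∈ S^{d-1}` and a pair of
incoming velocities `(v, v_*)`, the outgoing velocities are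
`v' = v - ((v - v_*)·ω) ω`, `v_*' = v_* + ((v - v_*)·ω) ω` (CIP 1994 (3.1.2); GST 2013 (1.1.2)). [cite: CIP1994, (3.1.2] -/
def collide (ω : sphere (0 : E) 1) (p : E × E) : E × E :=
  (p.1 - ⟪p.1 - p.2, (ω : E)⟫_ℝ • (ω : E), p.2 + ⟪p.1 - p.2, (ω : E)⟫_ℝ • (ω : E))

/-- A point `ω` of the unit sphere satisfies `⟪ω, ω⟫ = 1`. [folklore] -/
theorem real_inner_self_sphere (ω : sphere (0 : E) 1) : ⟪(ω : E), (ω : E)⟫_ℝ = 1 := by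
  rw [real_inner_self_eq_norm_sq, norm_eq_of_mem_sphere ω]; norm_num

/-- Conservation of momentum in an elastic collision: `v' + v_*' = v + v_*` (CIP 1994 §3.1). [cite: CIP1994, §3.1] -/
theorem collide_fst_add_collide_snd (ω : sphere (0 : E) 1) (p : E × E) :
    (collide ω p).1 + (collide ω p).2 = p.1 + p.2 := by
  simp only [collide]
  abel

/-- Conservation of kinetic energy in an elastic collision: `|v'|² + |v_*'|² = |v|² + |v_*|²`
(CIP 1994 §3.1). [cite: CIP1994, §3.1] -/
theorem norm_sq_collide_fst_add_norm_sq_collide_snd (ω : sphere (0 : E) 1) (p : E × E) :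
    ‖(collide ω p).1‖ ^ 2 + ‖(collide ω p).2‖ ^ 2 = ‖p.1‖ ^ 2 + ‖p.2‖ ^ 2 := by
  have h := real_inner_self_sphere ω
  simp only [collide, ← real_inner_self_eq_norm_sq, inner_sub_left, inner_sub_right,
    inner_add_left, inner_add_right, inner_smul_left, inner_smul_right, h,
    real_inner_comm (ω : E)]
  simp only [RCLike.conj_to_real]
  ring

/-- The elastic collision law with fixed impact direction is an involution (CIP 1994 §3.1). [cite: CIP1994, §3.1] -/
theorem collide_collide (ω : sphere (0 : E) 1) (p : E × E) : collide ω (collide ω p) = p := by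
  have h := real_inner_self_sphere ω
  obtain ⟨v, w⟩ := p
  simp only [collide, Prod.mk.injEq]
  have : ⟪v - ⟪v - w, (ω : E)⟫_ℝ • (ω : E) - (w + ⟪v - w, (ω : E)⟫_ℝ • (ω : E)), (ω : E)⟫_ℝ =
      -⟪v - w, (ω : E)⟫_ℝ := by
    simp only [inner_sub_left, inner_add_left, inner_smul_left, h, RCLike.conj_to_real]
    ring
  rw [this]
  constructor
  · rw [neg_smul, sub_neg_eq_add, sub_add_cancel]
  · rw [neg_smul, ← sub_eq_add_neg, add_sub_cancel_right]

/-- A function `φ` on velocity space is a *collision invariant* if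
`φ(v') + φ(v_*') = φ(v) + φ(v_*)` for all velocities `v, v_*` and impact directions `ω`
(CIP 1994 §3.1, Def. before (3.1.9)). [cite: CIP1994, §3.1  Def. before (3.1.9] -/
def IsCollisionInvariant (φ : E → ℝ) : Prop :=
  ∀ (ω : sphere (0 : E) 1) (p : E × E), φ (collide ω p).1 + φ (collide ω p).2 = φ p.1 + φ p.2

/-- The functions `v ↦ a + ⟪b, v⟫ + c |v|²` — in particular `1`, the components of `v`, and
`|v|²` — are collision invariants (CIP 1994 §3.1). [cite: CIP1994, §3.1] -/
theorem isCollisionInvariant_quadratic (a c : ℝ) (b : E) :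
    IsCollisionInvariant (fun v : E => a + ⟪b, v⟫_ℝ + c * ‖v‖ ^ 2) := by
  intro ω p
  have h1 := norm_sq_collide_fst_add_norm_sq_collide_snd ω p
  have h2 : ⟪b, (collide ω p).1⟫_ℝ + ⟪b, (collide ω p).2⟫_ℝ = ⟪b, p.1⟫_ℝ + ⟪b, p.2⟫_ℝ := by
    rw [← inner_add_right, ← inner_add_right]
    simp only [collide]
    congr 1
    abel
  linear_combination h2 + c * h1

/-! ### The hard-sphere collision operator (`hilbert6.S09`) -/

/-- The hard-sphere collision kernel `B(v - v_*, ω) = ((v - v_*)·ω)_+` (GST 2013 (2.1.1);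
CIP 1994 (3.1.4) up to the convention on the range of `ω`). [cite: GST2013, (2.1.1] -/
def hardSphereKernel (p : E × E) (ω : sphere (0 : E) 1) : ℝ :=
  max ⟪p.1 - p.2, (ω : E)⟫_ℝ 0

variable [FiniteDimensional ℝ E] [MeasurableSpace E] [BorelSpace E]

/-- The surface measure on the unit sphere `S^{d-1} ⊆ E` induced by Lebesgue measure
(Mathlib's `Measure.toSphere`; total mass `|S^{d-1}|`). [folklore] -/
def sphereMeasure : Measure (sphere (0 : E) 1) := (volume : Measure E).toSphere

/-- The pointwise collision integrand of `Q(f, g)` at `(v, v_*, ω)`: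
`((v - v_*)·ω)_+ (f(v') g(v_*') - f(v) g(v_*))` (CIP 1994 (3.1.4)). [cite: CIP1994, (3.1.4] -/
def collisionIntegrand (f g : E → ℝ) (p : E × E) (ω : sphere (0 : E) 1) : ℝ :=
  hardSphereKernel p ω * (f (collide ω p).1 * g (collide ω p).2 - f p.1 * g p.2)

/-- The gain part `Q⁺(f, g)(v) = ∫∫ ((v - v_*)·ω)_+ f(v') g(v_*') dω dv_*` of the hard-sphere
collision operator (CIP 1994 (3.1.11); Villani 2002 Ch. 1 §2.3). [cite: CIP1994, (3.1.11] -/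
def collisionGain (f g : E → ℝ) (v : E) : ℝ :=
  ∫ w, ∫ ω, hardSphereKernel (v, w) ω * (f (collide ω (v, w)).1 * g (collide ω (v, w)).2)
    ∂sphereMeasure

/-- The loss part `Q⁻(f, g)(v) = ∫∫ ((v - v_*)·ω)_+ f(v) g(v_*) dω dv_*` of the hard-sphere
collision operator (CIP 1994 (3.1.11); Villani 2002 Ch. 1 §2.3). [cite: CIP1994, (3.1.11] -/
def collisionLoss (f g : E → ℝ) (v : E) : ℝ :=
  ∫ w, ∫ ω, hardSphereKernel (v, w) ω * (f v * g w) ∂sphereMeasure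

/-- **hilbert6.S09** (hard-sphere Boltzmann collision operator; CIP 1994 §3.1 (3.1.4), Villani 2002
Ch. 1 §2). The bilinear hard-sphere collision operator
`Q(f, g)(v) = ∫_{E} ∫_{S^{d-1}} ((v - v_*)·ω)_+ [f(v') g(v_*') - f(v) g(v_*)] dω dv_*`;
the Boltzmann collision term is `Q(f, f) = collisionOp f f`. [cite: CIP1994, §3.1 (3.1.4] -/
def collisionOp (f g : E → ℝ) (v : E) : ℝ :=
  ∫ w, ∫ ω, collisionIntegrand f g (v, w) ω ∂sphereMeasure

/-- **hilbert6.S09** (gain/loss splitting; CIP 1994 (3.1.11)). If both the gain and the loss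
integrands are integrable over `E × S^{d-1}` at `v`, then `Q(f, g)(v) = Q⁺(f, g)(v) - Q⁻(f, g)(v)`.
[cite: CIP1994, (3.1.11] -/
def collisionOp_eq_gain_sub_loss : Prop :=
  ∀ (f g : E → ℝ) (v : E) (hgain : Integrable (fun q : E × sphere (0 : E) 1 => hardSphereKernel (v, q.1) q.2 * (f (collide q.2 (v, q.1)).1 * g (collide q.2 (v, q.1)).2)) (volume.prod sphereMeasure)) (hloss : Integrable (fun q : E × sphere (0 : E) 1 => hardSphereKernel (v, q.1) q.2 * (f v * g q.1)) (volume.prod sphereMeasure)),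
    collisionOp f g v = collisionGain f g v - collisionLoss f g v

/-- **hilbert6.S09** (weak formulation; CIP 1994 (3.1.7)–(3.1.9), Villani 2002 Ch. 1 §2.3
formula (40)). For a test function `φ`, if `(v, v_*, ω) ↦ B (f' f_*' - f f_*) φ(v)` is integrable
on `E × E × S^{d-1}`, then
`∫ Q(f,f) φ dv = ¼ ∫∫∫ ((v - v_*)·ω)_+ (f' f_*' - f f_*) (φ + φ_* - φ' - φ_*') dω dv_* dv`. [cite: CIP1994, (3.1.7] -/
def integral_collisionOp_mul : Prop :=
  ∀ (f φ : E → ℝ) (hint : Integrable (fun q : (E × E) × sphere (0 : E) 1 => collisionIntegrand f f q.1 q.2 * φ q.1.1) ((volume.prod volume).prod sphereMeasure)),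
    ∫ v, collisionOp f f v * φ v =
      (1 / 4 : ℝ) * ∫ q : (E × E) × sphere (0 : E) 1, collisionIntegrand f f q.1 q.2 *
        (φ q.1.1 + φ q.1.2 - φ (collide q.2 q.1).1 - φ (collide q.2 q.1).2)
        ∂((volume.prod volume).prod sphereMeasure)

/-- **hilbert6.S09** (collision invariants annihilate `Q`; CIP 1994 §3.1 Cor. after (3.1.9)).
If `φ` is a collision invariant (e.g. `1`, `v`, `|v|²`) and the weak-formulation integrand is
integrable, then `∫ Q(f,f) φ dv = 0`: formal conservation of mass, momentum and energy. [cite: CIP1994, §3.1 Cor. after (3.1.9] -/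
def integral_collisionOp_mul_eq_zero : Prop :=
  ∀ (f φ : E → ℝ) (hφ : IsCollisionInvariant φ) (hint : Integrable (fun q : (E × E) × sphere (0 : E) 1 => collisionIntegrand f f q.1 q.2 * φ q.1.1) ((volume.prod volume).prod sphereMeasure)),
    ∫ v, collisionOp f f v * φ v = 0

omit [FiniteDimensional ℝ E] [MeasurableSpace E] [BorelSpace E] in
/-- **hilbert6.S09** (classification of collision invariants; CIP 1994 Thm 3.1.1, going back to
Boltzmann, Gronwall and Carleman). In velocity dimension `d ≥ 2`, a *continuous* collision
invariant is of the form `φ(v) = a + ⟪b, v⟫ + c |v|²`. (In dimension `1` the hard-sphere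
collision merely swaps the two velocities and every function is an invariant.) [cite: CIP1994, Thm 3.1.1  going back to Boltzmann  Gron] -/
def IsCollisionInvariant.exists_eq_quadratic : Prop :=
  ∀ (hE : 2 ≤ Module.finrank ℝ E) {φ : E → ℝ} (hφ : IsCollisionInvariant φ) (hcont : Continuous φ),
    ∃ (a c : ℝ) (b : E), ∀ v, φ v = a + ⟪b, v⟫_ℝ + c * ‖v‖ ^ 2

/-! ### Boltzmann's H-theorem (`hilbert6.S12`) -/

omit [FiniteDimensional ℝ E] [MeasurableSpace E] [BorelSpace E] in
/-- A (wide-sense) *Maxwellian* on velocity space: `f(v) = exp (a + ⟪b, v⟫ + c |v|²)` for some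
`a c : ℝ`, `b : E`; for `c < 0` this is the local Maxwellian `M_{ρ,u,T}` with
`c = -1/(2T)`, `b = u/T` (CIP 1994 §3.2; Villani 2002 Ch. 1 §2.4). No sign condition on `c` is
imposed here, since the H-theorem below does not assume `f ∈ L¹`. [cite: CIP1994, §3.2] -/
def IsMaxwellian (f : E → ℝ) : Prop :=
  ∃ (a c : ℝ) (b : E), ∀ v, f v = exp (a + ⟪b, v⟫_ℝ + c * ‖v‖ ^ 2)

/-- **hilbert6.S12** (Maxwellians are equilibria; Boltzmann 1872, CIP 1994 §3.2). For a
Maxwellian `M` the collision integrand vanishes identically, hence `Q(M, M) = 0`. [cite: Boltzmann1872, CIP 1994 §3.2] -/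
theorem collisionOp_eq_zero_of_isMaxwellian {f : E → ℝ} (hf : IsMaxwellian f) (v : E) :
    collisionOp f f v = 0 := by
  obtain ⟨a, c, b, hf⟩ := hf
  have h : ∀ (w : E) (ω : sphere (0 : E) 1), collisionIntegrand f f (v, w) ω = 0 := by
    intro w ω
    have hi := isCollisionInvariant_quadratic a c b ω (v, w)
    simp only [collisionIntegrand, hf, ← Real.exp_add, hi, sub_self, mul_zero]
  simp [collisionOp, h]

/-- **hilbert6.S12** (Boltzmann's H-theorem, inequality; Boltzmann 1872, CIP 1994 §3.2–3.3,
Villani 2002 Ch. 1 §2.4). Let `f > 0` be such that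
`(v, v_*, ω) ↦ ((v - v_*)·ω)_+ (f' f_*' - f f_*) log f(v)` is integrable on `E × E × S^{d-1}`
("sufficiently integrable"). Then the entropy production is signed:
`∫ Q(f,f)(v) log f(v) dv = -¼ ∫∫∫ B (f' f_*' - f f_*) log (f' f_*' / (f f_*)) ≤ 0`.
Consequently, formally, `d/dt ∫ f log f ≤ 0` along solutions of the Boltzmann equation. [cite: Boltzmann1872, CIP 1994 §3.2–3.3  Villani 2002 Ch. 1 §2] -/
def integral_collisionOp_mul_log_nonpos : Prop :=
  ∀ (f : E → ℝ) (hpos : ∀ v, 0 < f v) (hint : Integrable (fun q : (E × E) × sphere (0 : E) 1 => collisionIntegrand f f q.1 q.2 * log (f q.1.1)) ((volume.prod volume).prod sphereMeasure)),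
    ∫ v, collisionOp f f v * log (f v) ≤ 0

/-- **hilbert6.S12** (Boltzmann's H-theorem, equality case; Boltzmann 1872, CIP 1994 §3.2–3.3
with Thm 3.1.1, Villani 2002 Ch. 1 §2.4). In velocity dimension `d ≥ 2`, for a continuous
positive `f` satisfying the integrability condition of `integral_collisionOp_mul_log_nonpos`,
the entropy production `∫ Q(f,f) log f dv` vanishes if and only if `f` is a Maxwellian. [cite: Boltzmann1872, CIP 1994 §3.2–3.3 with Thm 3.1.1  Villan] -/
def integral_collisionOp_mul_log_eq_zero_iff : Prop :=
  ∀ (hE : 2 ≤ Module.finrank ℝ E) (f : E → ℝ) (hpos : ∀ v, 0 < f v) (hcont : Continuous f) (hint : Integrable (fun q : (E × E) × sphere (0 : E) 1 => collisionIntegrand f f q.1 q.2 * log (f q.1.1)) ((volume.prod volume).prod sphereMeasure)),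
    ∫ v, collisionOp f f v * log (f v) = 0 ↔ IsMaxwellian f

end

end Literature.MathematicalPhysics.KineticTheory
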